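import Literature.NumberTheory.LFunctions.PsdDyadicCertificate
import HarnessLib

/-!
# Format C: the DIAGONAL-SHIFT kernel checker of the odd-sector λ-run (`DS' = DS − lamZ·1`)

Helper file (`--supports stmt-RiemannHypothesis-18085`, the parity ladder / `NoParityCrossing`), RH-free, pure list
bookkeeping.  Prover A (g22 of unit `sr-gb-rung-a`, route GroundBarta).  The odd-sector λ-door
`WeilFormatC.le_weilOddGroundEnergy_of_kitCBM_odd` (`WeilFormatCOddMarginDoorA.lean`) reads the Schur bands of the kit
against the UNshifted claimed midpoints `DS` and the PSD certificate `checkPsdMid` against the SHIFTED table `DS'`, linked by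
`hDS : ∀ k < B, ∀ k' < B, getMZ DS' k k' = getMZ DS k k' − [k = k']·lamZ`.  The generated (P) files prove `hDS` in row bands
with the Boolean checker below (`decide +kernel`) and assemble it with `diagShift_row_of_check`.

* `checkDiagShiftRows B DS DS' z i0 k` — rows `i ∈ [i0, i0+k)`, columns `j < B`: `getMZ DS' i j == getMZ DS i j − [i = j]·z`;
* `diagShift_row_of_check` — its soundness, row by row.

Standard axioms; no RH claim.
-/

set_option linter.dupNamespace false
set_option autoImplicit false

namespace Summit.RiemannHypothesis.RiemannHypothesis.Theorems.WeilFormatC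

open Literature.NumberTheory.LFunctions

/-- Kernel checker: on the rows `i ∈ [i0, i0 + k)` and columns `j < B`, the table `DS'` is `DS` with `z` subtracted on the
diagonal (`PsdDyadic.getMZ` indexing, out-of-range entries read as `0` on both sides). [folklore] -/
def checkDiagShiftRows (B : ℕ) (DS DS' : List (List ℤ)) (z : ℤ) (i0 k : ℕ) : Bool :=
  (List.range' i0 k).all fun i ↦ (List.range B).all fun j ↦
    PsdDyadic.getMZ DS' i j == PsdDyadic.getMZ DS i j - (if i = j then z else 0)

/-- Soundness of `checkDiagShiftRows`: every row of the band satisfies the shift identity. [folklore] -/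
theorem diagShift_row_of_check {B : ℕ} {DS DS' : List (List ℤ)} {z : ℤ} {i0 k : ℕ}
    (h : checkDiagShiftRows B DS DS' z i0 k = true) :
    ∀ i, i0 ≤ i → i < i0 + k → ∀ j < B,
      PsdDyadic.getMZ DS' i j = PsdDyadic.getMZ DS i j - (if i = j then z else 0) := by
  intro i hi0 hik j hj
  simp only [checkDiagShiftRows, List.all_eq_true, List.mem_range'_1, List.mem_range, beq_iff_eq] at h
  exact h i ⟨hi0, by omega⟩ j hj

end Summit.RiemannHypothesis.RiemannHypothesis.Theorems.WeilFormatC
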